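import Literature.AlgebraicGeometry.Resolution.CanonicalResolutionProofs
import Mathlib.AlgebraicGeometry.Morphisms.FiniteType
import Mathlib.Topology.JacobsonSpace
import Mathlib.RingTheory.Jacobson.Ring
import HarnessLib

/-!
# Crux `FrobeniusLadder.FRationalResolution` (stmt-ResolutionOfSingularities-15317), line `redirect`,
# stub `stub_diagonalizableQuotientResolution` — isolated singular points are closed points

Small input of every isolated-singularity assembly (`…PointBlowupEtale.lean`, `…VeroneseEtale.lean`, `…ChartHloc.lean`
need the singular point as a MAXIMAL ideal of an affine open): on a scheme locally of finite type over a field (a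
Jacobson space, Mathlib `LocallyOfFiniteType.jacobsonSpace`) a point of the finite closed set `X ∖ Reg X` is a
closed point — its singleton is locally closed (remove the closures of the finitely many other points of its closure,
`T0`), hence closed in a Jacobson space (`isClosed_singleton_of_isLocallyClosed_singleton`).

* `isLocallyClosed_singleton_of_finite_closed` — a point of a finite closed subset of a `T0` space has locally closed
  singleton;
* `isClosed_singleton_of_finite_singularLocus` — **isolated singular points of a `k`-scheme locally of finite type
  are closed points.**

Honest label: plumbing (no stub closed). No definitions, no named facts, no sorry. [folklore; cite: StacksProject, Tag 01TB]
-/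

noncomputable section

-- single-problem summit: the doubled namespace component is forced
set_option linter.dupNamespace false

open CategoryTheory AlgebraicGeometry TopologicalSpace
open Literature.AlgebraicGeometry.Resolution

namespace Summit.ResolutionOfSingularities.ResolutionOfSingularities.Theorems.FRationalResolution.IsolatedClosed

/-- **A point of a finite closed subset of a `T0` space has locally closed singleton**: `{s} = U ∩ closure {s}` with
`U` the complement of the closures of the other points of `closure {s}` (finitely many, as `closure {s} ⊆ Z`).
[folklore] -/
theorem isLocallyClosed_singleton_of_finite_closed {X : Type*} [TopologicalSpace X] [T0Space X]
    {Z : Set X} (hZ : IsClosed Z) (hfin : Z.Finite) {s : X} (hs : s ∈ Z) : IsLocallyClosed ({s} : Set X) := by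
  classical
  have hcl : closure ({s} : Set X) ⊆ Z := hZ.closure_subset_iff.mpr (Set.singleton_subset_iff.mpr hs)
  -- the other points of the closure of `s`
  set T : Set X := {z | z ∈ closure ({s} : Set X) ∧ z ≠ s} with hT
  have hTfin : T.Finite := hfin.subset fun z hz => hcl hz.1
  set U : Set X := (⋃ z ∈ T, closure ({z} : Set X))ᶜ with hU
  have hUopen : IsOpen U := by
    rw [hU, isOpen_compl_iff]
    exact hTfin.isClosed_biUnion fun z _ => isClosed_closure
  refine ⟨U, closure {s}, hUopen, isClosed_closure, ?_⟩
  ext z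
  constructor
  · rintro rfl
    refine ⟨?_, subset_closure rfl⟩
    rw [hU, Set.mem_compl_iff, Set.mem_iUnion₂]
    rintro ⟨w, ⟨hw, hws⟩, hzw⟩
    -- `z ⤳ w` and `w ⤳ z` in a T0 space force `w = z`
    have h1 : w ⤳ z := specializes_iff_mem_closure.mpr hzw
    have h2 : z ⤳ w := specializes_iff_mem_closure.mpr hw
    exact hws ((h1.antisymm h2).eq)
  · rintro ⟨hzU, hzs⟩
    by_contra hne
    have hzT : z ∈ T := ⟨hzs, hne⟩
    apply hzU
    exact Set.mem_iUnion₂.mpr ⟨z, hzT, subset_closure rfl⟩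

/-- **Isolated singular points are closed points.** For a scheme `X` locally of finite type over a field `k` whose
singular locus `X ∖ Reg X` is finite, every singular point is a closed point of `X` (`X` is a Jacobson space and the
singleton is locally closed). [cite: StacksProject, Tag 01TB] -/
theorem isClosed_singleton_of_finite_singularLocus (k : Type) [Field k] (X : Scheme.{0})
    (f : X ⟶ Spec (.of k)) [LocallyOfFiniteType f] (hfin : (Scheme.regularLocus X)ᶜ.Finite)
    {s : X} (hs : s ∉ Scheme.regularLocus X) : IsClosed ({s} : Set X) := by
  haveI : JacobsonSpace X := LocallyOfFiniteType.jacobsonSpace f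
  have hclosed : IsClosed (Scheme.regularLocus X)ᶜ :=
    (isOpen_regularLocus_of_locallyOfFiniteType_field f).isClosed_compl
  exact isClosed_singleton_of_isLocallyClosed_singleton
    (isLocallyClosed_singleton_of_finite_closed hclosed hfin hs)

end Summit.ResolutionOfSingularities.ResolutionOfSingularities.Theorems.FRationalResolution.IsolatedClosed

end
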